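/-
Copyright (c) 2026 the pub-hodgecm-mathlib formalisation cell (harness21).  Prover seat hodgecm-mathlib-K2Liu-p11 (g3), Track B «K2-LIT»,
#184♮ = hLiu418 = `stmt-HodgeConjecture-24832`; organ (σ) A7-val, V6-inst TODO-3 (the `hBP` socket), FILE F2: the slice letter and the Jacobian of a PARTNER element
stabilising the slice line (twin of ★ S-2c (b)∕(c) for the Levi).  THEOREMS ONLY (no `def`, no `instance`, no notation, no named-fact hypothesis, no `sorry`).
-/
import Summits.HodgeConjecture.HodgeConjecture.Theorems.K2LiuKRFrameLeviSlice       -- ★ S-2c (b) p860871 (brings ★ `K2LiuKRFrameComponents`, ★ S-0a `K2LiuKRFrameDefs`, ★ I-0 `leviAct`)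
import Summits.HodgeConjecture.HodgeConjecture.Theorems.K2LiuKRFrameLeviJacobian    -- ★ S-2c (c) p860917 (`coe_inv_distribHaarChar_det_leviAct_inv`)
import Literature.NumberTheory.Automorphic.LocalRingUnitModulusProduct              -- ★ `unitModulusChar_localRing_eq_prod`
import HarnessLib

/-!
# Crux `HLiu418`, (σ) V6-inst TODO-3, FILE F2: A PARTNER ELEMENT STABILISING THE SLICE LINE ACTS ON THE INTEGRATED BLOCK BY ITS EIGENVALUE;
# the Jacobian is `‖t‖_{L⊗L⁺_v}^n`

Cell `hodgecm-mathlib`, crux item hLiu418 = `stmt-HodgeConjecture-24832` (helper lane `--supports`, count-neutral); squad K2 ∕ K2Liu, prover K2Liu-p11 (g3).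
D10 currency of ★ S-0a `(F E c hcδ hδ v n eV P A)` (`R = E ⊗ F_v`, Witt frame `P ∈ GL₃(R)` BY VALUE, twisted Kudla–Rallis frame `θ = krFrameTw eV P A`).

THE DICTIONARY (★ I-2): the partner `g ∈ U(V′_v)` acts on `X_Δ(𝔻 ⊗ V′)` through `G = D(1 ⊗ g) = reindex eV (1_n ⊗ₖ g)`, i.e. on `n × 3` matrices `X` over `R` by
`X i ↦ g · X i` (rows = vectors of `V′_v`).  The integrated slice `θ⁻¹((0 ⊔ 0) ⊔ t)` has Witt rows `Y i = (R⁻¹t)ᵢ • e₀` (★ `wittMatrix_krFrameTw_symm_slice`), i.e. `X i ∈ R · x₀`,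
**`x₀ := P⁻¹ e₀`** (the isotropic `x′`-line).  So if `M x₀ = s x₀` (`M` the matrix of `g⁻¹`, `s = t_g⁻¹`):
* §1 `matOfVec_reindex_one_kronecker_mulVec` (`(1 ⊗ M)·b` read as a matrix is `X i ↦ M · X i`), `colMix_colOp` (`P (M X i) = (P M P⁻¹)(P X i)`),
  `conj_mulVec_single_of_mulVec_eq` (`(PMP⁻¹) e₀ = s e₀`);
* §2 **`krFrameTw_leviAct_inv_slice_of_partner`**: `θ (leviAct G⁻¹ (θ⁻¹((0 ⊔ 0) ⊔ t))) = (0 ⊔ 0) ⊔ R (s • R⁻¹ t)` for `G⁻¹ = reindex eV (1 ⊗ₖ M)`, `M x₀ = s • x₀` — the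
  slice is mapped to itself, scaled by `s`; **`krFrameTw_leviAct_symm_slice_mulVec_of_partner`** — the `hS0` shape of ★ S-2a `krFun_zero_leviOp` with the slice matrix
  `D_g := toMatrix' (leviAct_n (t_g • 1)⁻¹)` (`s = t_g⁻¹`, `t_g ∈ Rˣ`);
* §3 **`coe_inv_distribHaarChar_det_leviAct_scalar_inv`**: the Jacobian `(mod_{F_v}(det D_g))⁻¹ = ∏_{w ∣ v} ‖t_{g,w}‖_w^n = ‖t_g‖_R^n` (★ S-2c (c) at the scalar `t_g • 1`,
  ★ `unitModulusChar_localRing_eq_prod`; `‖·‖_R = ` ★ `unitModulusChar R = distribHaarChar R`).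
With ★ S-2a this gives `Λ(leviOp (ρ g) Ψ) = ‖t_g‖_R^n · Λ(Ψ)` for the Kudla–Rallis functional — the `B`-half of the `hBP` law (FILE F3; `n = 2` against `Δ_{P′} = ‖t_g‖²`, FILE F1).
References: [KudlaRallis1994, §1]; [Kudla1994, §3 Thm. 3.1]; [KudlaSweet1997, §1]; [WeilBNT1967, Ch. I §2].
HONEST LABEL: HC_CM is proved only modulo the 7 printed citations (2 remaining named inputs: hLiu418 = stmt-HodgeConjecture-24832,
h413 = stmt-HodgeConjecture-24833) until rung 0 closes; count-neutral helper, closes no socket by itself.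
-/

set_option autoImplicit false
set_option linter.dupNamespace false -- the mandated namespace repeats `HodgeConjecture.HodgeConjecture`

noncomputable section

open scoped Matrix Kronecker NNReal
open NumberField IsDedekindDomain Matrix MeasureTheory
open Literature.NumberTheory.GaloisRepresentations Literature.NumberTheory.GaloisRepresentations.IsNonarchimedeanLocalField
open Literature.NumberTheory.Automorphic Literature.NumberTheory.Automorphic.UnitaryGroup
open Summit.HodgeConjecture.HodgeConjecture.Cruxes.HLiu418.K2LiuDeltaModelRealFrame
open Summit.HodgeConjecture.HodgeConjecture.Cruxes.HLiu418.K2LiuKRFrameDefs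
open Summit.HodgeConjecture.HodgeConjecture.Cruxes.HLiu418.K2LiuKRFrameComponents
open Summit.HodgeConjecture.HodgeConjecture.Cruxes.HLiu418.K2LiuKRFrameLeviSlice
open Summit.HodgeConjecture.HodgeConjecture.Cruxes.HLiu418.K2LiuKRFrameLeviJacobian

namespace Summit.HodgeConjecture.HodgeConjecture.Cruxes.HLiu418.K2LiuKRFramePartnerSlice

variable (F : Type) [Field F] [NumberField F] (E : Type) [Field E] [NumberField E] [Algebra F E]
  [Algebra.IsQuadraticExtension F E] (c : E ≃ₐ[F] E)
  {δ : E} (hcδ : c δ = -δ) (hδ : δ ≠ 0) (v : HeightOneSpectrum (𝓞 F)) (n : ℕ) {n₃ : ℕ} (eV : Fin n × Fin 3 ≃ Fin n₃)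
  (P : GL (Fin 3) (LocalRing E v)) (A : (Fin (n + n) → v.adicCompletion F) ≃ₗ[v.adicCompletion F] (Fin (n + n) → v.adicCompletion F))

/-! ## §1 Column operations on the Witt matrix -/

omit [Algebra.IsQuadraticExtension F E] in
/-- `(1 ⊗ M)·b`, read as an `n × 3` matrix, is `X i ↦ M · X i` (the partner acts on the `V′`-index). [cite: Kudla1994, §3 Thm. 3.1] -/
theorem matOfVec_reindex_one_kronecker_mulVec (M : Matrix (Fin 3) (Fin 3) (LocalRing E v)) (b : Fin n₃ → LocalRing E v) (i : Fin n) (k : Fin 3) :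
    matOfVec F E v n eV (Matrix.reindex eV eV ((1 : Matrix (Fin n) (Fin n) (LocalRing E v)) ⊗ₖ M) *ᵥ b) i k =
      (M *ᵥ matOfVec F E v n eV b i) k := by
  rw [K2LiuKRFrameDefs.matOfVec_apply, Matrix.mulVec, dotProduct, Matrix.mulVec, dotProduct]
  simp only [K2LiuKRFrameDefs.matOfVec_apply]
  rw [← Equiv.sum_comp eV, Fintype.sum_prod_type, Finset.sum_eq_single i]
  · refine Finset.sum_congr rfl fun l _ => ?_
    simp [Matrix.reindex_apply, Matrix.submatrix_apply, Matrix.kroneckerMap_apply, Matrix.one_apply_eq]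
  · intro j _ hj
    simp [Matrix.reindex_apply, Matrix.submatrix_apply, Matrix.kroneckerMap_apply, Matrix.one_apply_ne' hj]
  · intro h; exact absurd (Finset.mem_univ i) h

omit [Algebra.IsQuadraticExtension F E] in
/-- column operations under the Witt column mix: `P (M X i) = (P M P⁻¹) (P X i)`. [cite: KudlaRallis1994, §1] -/
theorem colMix_colOp (M : Matrix (Fin 3) (Fin 3) (LocalRing E v)) (X : Fin n → Fin 3 → LocalRing E v) :
    colMix F E v n P (fun i => M *ᵥ X i) = fun i => (P.val * M * P⁻¹.val) *ᵥ colMix F E v n P X i := by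
  funext i
  rw [colMix_apply, colMix_apply, Matrix.mulVec_mulVec, Matrix.mulVec_mulVec, Matrix.mul_assoc (P.val * M), ← Units.val_mul, inv_mul_cancel,
    Units.val_one, Matrix.mul_one]

omit [NumberField F] [Algebra.IsQuadraticExtension F E] in
/-- `M x₀ = s x₀` with `P x₀ = e₀` ⇒ `(P M P⁻¹) e₀ = s e₀`. [folklore] -/
theorem conj_mulVec_single_of_mulVec_eq (M : Matrix (Fin 3) (Fin 3) (LocalRing E v)) (x₀ : Fin 3 → LocalRing E v) (hx₀ : P.val *ᵥ x₀ = Pi.single 0 1)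
    {s : LocalRing E v} (hM : M *ᵥ x₀ = s • x₀) :
    (P.val * M * P⁻¹.val) *ᵥ (Pi.single 0 1 : Fin 3 → LocalRing E v) = s • Pi.single 0 1 := by
  have hinv : P⁻¹.val *ᵥ (Pi.single 0 1 : Fin 3 → LocalRing E v) = x₀ := by
    rw [← hx₀, Matrix.mulVec_mulVec, ← Units.val_mul, inv_mul_cancel, Units.val_one, Matrix.one_mulVec]
  rw [← Matrix.mulVec_mulVec, ← Matrix.mulVec_mulVec, hinv, hM, Matrix.mulVec_smul, hx₀]

omit [NumberField F] [Algebra.IsQuadraticExtension F E] in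
/-- the scalar unit `t • 1 ∈ GL_n(R)`: `(t • 1)⁻¹ b = t⁻¹ • b`. [folklore] -/
theorem scalar_inv_mulVec (tg : (LocalRing E v)ˣ) (b : Fin n → LocalRing E v) :
    (Units.map (Matrix.scalar (Fin n) : LocalRing E v →+* Matrix (Fin n) (Fin n) (LocalRing E v)).toMonoidHom tg)⁻¹.val *ᵥ b =
      ((tg⁻¹ : (LocalRing E v)ˣ) : LocalRing E v) • b := by
  rw [← map_inv, Units.coe_map]
  change Matrix.scalar (Fin n) (((tg⁻¹ : (LocalRing E v)ˣ) : LocalRing E v)) *ᵥ b = _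
  rw [Matrix.scalar_apply, ← Matrix.smul_one_eq_diagonal, Matrix.smul_mulVec, Matrix.one_mulVec]

/-! ## §2 The partner slice letter -/

/-- **THE PARTNER SLICE LETTER**: if `G⁻¹ = reindex eV (1 ⊗ₖ M)` with `M x₀ = s • x₀`, `x₀ = P⁻¹e₀` (the integrated line), then `leviAct G⁻¹` maps the slice point
`θ⁻¹((0 ⊔ 0) ⊔ t)` (Witt rows `(R⁻¹t)ᵢ • e₀`) to the slice point with integrated block `R (s • R⁻¹ t)`. [cite: KudlaRallis1994, §1] [cite: Kudla1994, §3 Thm. 3.1] [cite: KudlaSweet1997, §1] -/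
theorem krFrameTw_leviAct_inv_slice_of_partner (G : GL (Fin n₃) (LocalRing E v)) (M : Matrix (Fin 3) (Fin 3) (LocalRing E v))
    (hG : G⁻¹.val = Matrix.reindex eV eV ((1 : Matrix (Fin n) (Fin n) (LocalRing E v)) ⊗ₖ M))
    (x₀ : Fin 3 → LocalRing E v) (hx₀ : P.val *ᵥ x₀ = Pi.single 0 1) {s : LocalRing E v} (hM : M *ᵥ x₀ = s • x₀)
    (t : Fin (n + n) → v.adicCompletion F) :
    krFrameTw F E c hcδ hδ v n eV P A (leviAct F E c hcδ hδ v n₃ G⁻¹ ((krFrameTw F E c hcδ hδ v n eV P A).symm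
        (Sum.elim (Sum.elim (0 : Fin (n + n) → v.adicCompletion F) (0 : Fin (n + n) → v.adicCompletion F)) t))) =
      Sum.elim (Sum.elim (0 : Fin (n + n) → v.adicCompletion F) (0 : Fin (n + n) → v.adicCompletion F))
        (reFrame F E c hcδ hδ v n (s • (reFrame F E c hcδ hδ v n).symm t)) := by
  rw [krFrameTw_apply_eq, leviAct_apply, LinearEquiv.symm_apply_apply, hG]
  -- the Witt matrix of the moved point: columns operated on by `N := P M P⁻¹`
  have hW : colMix F E v n P (matOfVec F E v n eV (Matrix.reindex eV eV ((1 : Matrix (Fin n) (Fin n) (LocalRing E v)) ⊗ₖ M) *ᵥ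
      (reFrame F E c hcδ hδ v n₃).symm ((krFrameTw F E c hcδ hδ v n eV P A).symm (Sum.elim (Sum.elim (0 : Fin (n + n) → v.adicCompletion F) (0 : Fin (n + n) → v.adicCompletion F)) t)))) =
      fun i => (P.val * M * P⁻¹.val) *ᵥ colMix F E v n P (matOfVec F E v n eV ((reFrame F E c hcδ hδ v n₃).symm
        ((krFrameTw F E c hcδ hδ v n eV P A).symm (Sum.elim (Sum.elim (0 : Fin (n + n) → v.adicCompletion F) (0 : Fin (n + n) → v.adicCompletion F)) t)))) i := by
    rw [← colMix_colOp]
    congr 1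
    funext i k
    exact matOfVec_reindex_one_kronecker_mulVec F E v n eV M _ i k
  -- the corner column of `N := P M P⁻¹`: `N e₀ = s e₀`
  have hN : ∀ k : Fin 3, (P.val * M * P⁻¹.val) k 0 = if k = 0 then s else 0 := fun k => by
    have hk := congrFun (conj_mulVec_single_of_mulVec_eq F E v P M x₀ hx₀ hM) k
    rw [Matrix.mulVec_single_one, Matrix.col_apply, Pi.smul_apply, smul_eq_mul] at hk
    rw [hk]
    by_cases h0 : k = 0
    · rw [h0, Pi.single_eq_same, mul_one, if_pos rfl]
    · rw [Pi.single_eq_of_ne h0, mul_zero, if_neg h0]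
  -- the new Witt rows: `N (Y i) = s (R⁻¹ t)ᵢ • e₀` (old rows `Y i = (R⁻¹t)ᵢ • e₀`, ★ `wittMatrix_krFrameTw_symm_slice`)
  have hrow : ∀ (i : Fin n) (k : Fin 3), ((P.val * M * P⁻¹.val) *ᵥ colMix F E v n P (matOfVec F E v n eV ((reFrame F E c hcδ hδ v n₃).symm
      ((krFrameTw F E c hcδ hδ v n eV P A).symm (Sum.elim (Sum.elim (0 : Fin (n + n) → v.adicCompletion F) (0 : Fin (n + n) → v.adicCompletion F)) t)))) i) k =
      (if k = 0 then s else 0) * (reFrame F E c hcδ hδ v n).symm t i := by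
    intro i k
    obtain ⟨h0, h1, h2⟩ := wittMatrix_krFrameTw_symm_slice F E c hcδ hδ v n eV P A (0 : Fin (n + n) → v.adicCompletion F) t i
    rw [Matrix.mulVec, dotProduct, Fin.sum_univ_three, h0, h1, h2, map_zero, Pi.zero_apply, mul_zero, mul_zero, add_zero, add_zero, hN]
  rw [hW]
  have hc2 : (fun i => ((P.val * M * P⁻¹.val) *ᵥ colMix F E v n P (matOfVec F E v n eV ((reFrame F E c hcδ hδ v n₃).symm
      ((krFrameTw F E c hcδ hδ v n eV P A).symm (Sum.elim (Sum.elim (0 : Fin (n + n) → v.adicCompletion F) (0 : Fin (n + n) → v.adicCompletion F)) t)))) i) 2) = 0 := by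
    funext i; rw [hrow, if_neg (by decide), zero_mul, Pi.zero_apply]
  have hc1 : (fun i => ((P.val * M * P⁻¹.val) *ᵥ colMix F E v n P (matOfVec F E v n eV ((reFrame F E c hcδ hδ v n₃).symm
      ((krFrameTw F E c hcδ hδ v n eV P A).symm (Sum.elim (Sum.elim (0 : Fin (n + n) → v.adicCompletion F) (0 : Fin (n + n) → v.adicCompletion F)) t)))) i) 1) = 0 := by
    funext i; rw [hrow, if_neg (by decide), zero_mul, Pi.zero_apply]
  have hc0 : (fun i => ((P.val * M * P⁻¹.val) *ᵥ colMix F E v n P (matOfVec F E v n eV ((reFrame F E c hcδ hδ v n₃).symm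
      ((krFrameTw F E c hcδ hδ v n eV P A).symm (Sum.elim (Sum.elim (0 : Fin (n + n) → v.adicCompletion F) (0 : Fin (n + n) → v.adicCompletion F)) t)))) i) 0) =
      s • (reFrame F E c hcδ hδ v n).symm t := by
    funext i; rw [hrow, if_pos rfl, Pi.smul_apply, smul_eq_mul]
  rw [hc2, hc1, hc0, map_zero, map_zero, sumGlue_apply]

/-- **THE `hS0` SHAPE** (★ S-2a `krFun_zero_leviOp`, operator `A := leviAct G`, so `A⁻¹ = leviAct G⁻¹`): with a unit eigenvalue `t_g` of `g` on `x₀` (so `g⁻¹ x₀ = t_g⁻¹ x₀`,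
hypothesis `hM` on the matrix `M` of `g⁻¹`), the integrated block is hit by the slice matrix `D_g := toMatrix' (leviAct_n (t_g • 1)⁻¹)`.
[cite: KudlaRallis1994, §1] [cite: KudlaSweet1997, §1] -/
theorem krFrameTw_leviAct_symm_slice_mulVec_of_partner (G : GL (Fin n₃) (LocalRing E v)) (M : Matrix (Fin 3) (Fin 3) (LocalRing E v))
    (hG : G⁻¹.val = Matrix.reindex eV eV ((1 : Matrix (Fin n) (Fin n) (LocalRing E v)) ⊗ₖ M))
    (x₀ : Fin 3 → LocalRing E v) (hx₀ : P.val *ᵥ x₀ = Pi.single 0 1) (tg : (LocalRing E v)ˣ) (hM : M *ᵥ x₀ = ((tg⁻¹ : (LocalRing E v)ˣ) : LocalRing E v) • x₀)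
    (t : Fin (n + n) → v.adicCompletion F) :
    krFrameTw F E c hcδ hδ v n eV P A ((leviAct F E c hcδ hδ v n₃ G).symm ((krFrameTw F E c hcδ hδ v n eV P A).symm
        (Sum.elim (Sum.elim (0 : Fin (n + n) → v.adicCompletion F) (0 : Fin (n + n) → v.adicCompletion F)) t))) =
      Sum.elim (Sum.elim (0 : Fin (n + n) → v.adicCompletion F) (0 : Fin (n + n) → v.adicCompletion F))
        (LinearMap.toMatrix' ((leviAct F E c hcδ hδ v n (Units.map (Matrix.scalar (Fin n) : LocalRing E v →+* Matrix (Fin n) (Fin n) (LocalRing E v)).toMonoidHom tg)⁻¹ :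
          (Fin (n + n) → v.adicCompletion F) ≃ₗ[v.adicCompletion F] (Fin (n + n) → v.adicCompletion F)) : (Fin (n + n) → v.adicCompletion F) →ₗ[v.adicCompletion F] (Fin (n + n) → v.adicCompletion F)) *ᵥ t) := by
  rw [LinearMap.toMatrix'_mulVec, show (leviAct F E c hcδ hδ v n₃ G).symm = leviAct F E c hcδ hδ v n₃ G⁻¹ by rw [map_inv]; rfl,
    krFrameTw_leviAct_inv_slice_of_partner F E c hcδ hδ v n eV P A G M hG x₀ hx₀ hM t]
  congr 1
  change reFrame F E c hcδ hδ v n _ = leviAct F E c hcδ hδ v n _ t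
  rw [leviAct_apply, scalar_inv_mulVec]

/-! ## §3 The Jacobian of the scalar `t_g • 1` -/

omit [NumberField F] [Algebra.IsQuadraticExtension F E] in
/-- Mathlib's norm on `E_w` is the normalised absolute value (reproduced, as in ★ S-2c (c), to keep imports small). [folklore] -/
private theorem norm_eq_coe_normAbs' (w : PlacesOver E v) (x : w.1.adicCompletion E) : ‖x‖ = ((normAbs (w.1.adicCompletion E) x : ℝ≥0) : ℝ) := by
  by_cases hx : x = 0
  · rw [hx, norm_zero, map_zero, NNReal.coe_zero]
  have hv : Valued.v x ≠ 0 := (Valuation.ne_zero_iff _).2 hx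
  have hxn : Valued.v x = WithZero.exp (Multiplicative.toAdd (WithZero.unzero hv)) := by
    rw [WithZero.exp, ofAdd_toAdd, WithZero.coe_unzero]
  rw [FinitePlace.norm_def, WithZeroMulInt.toNNReal_neg_apply _ hv,
    normAbs_eq_inv_zpow_of_valued_eq w.1 hxn, residueFieldCard_adicCompletion_eq, _root_.inv_zpow', neg_neg]
  rfl

/-- **THE JACOBIAN OF THE SCALAR**: `((mod_{F_v}(det D_g))⁻¹ : ℝ) = ‖t_g‖_R ^ n` for `D_g = toMatrix' (leviAct_n (t_g • 1)⁻¹)` (any proof `h` of `det D_g ≠ 0`), `‖·‖_R = unitModulusChar R`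
(★ S-2c (c): `= ∏_w ‖(det (t_g • 1))_w‖ = ∏_w ‖t_{g,w}‖^n`; ★ `unitModulusChar_localRing_eq_prod`). [cite: WeilBNT1967, Ch. I §2] [cite: KudlaRallis1994, §1] -/
theorem coe_inv_distribHaarChar_det_leviAct_scalar_inv (tg : (LocalRing E v)ˣ)
    (h : (LinearMap.toMatrix' ((leviAct F E c hcδ hδ v n (Units.map (Matrix.scalar (Fin n) : LocalRing E v →+* Matrix (Fin n) (Fin n) (LocalRing E v)).toMonoidHom tg)⁻¹ :
      (Fin (n + n) → v.adicCompletion F) ≃ₗ[v.adicCompletion F] (Fin (n + n) → v.adicCompletion F)) : (Fin (n + n) → v.adicCompletion F) →ₗ[v.adicCompletion F] (Fin (n + n) → v.adicCompletion F))).det ≠ 0) :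
    (((distribHaarChar (v.adicCompletion F) (Units.mk0 _ h))⁻¹ : ℝ≥0) : ℝ) = ((unitModulusChar (LocalRing E v) tg : ℝ≥0) : ℝ) ^ n := by
  rw [coe_inv_distribHaarChar_det_leviAct_inv F E c hcδ hδ v n _ h]
  have hval : (Units.map (Matrix.scalar (Fin n) : LocalRing E v →+* Matrix (Fin n) (Fin n) (LocalRing E v)).toMonoidHom tg).val =
      Matrix.diagonal fun _ : Fin n => (tg : LocalRing E v) := by
    rw [Units.coe_map]
    exact Matrix.scalar_apply _
  rw [hval, Matrix.det_diagonal, Finset.prod_const, Finset.card_univ, Fintype.card_fin, unitModulusChar_localRing_eq_prod, NNReal.coe_prod, ← Finset.prod_pow]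
  refine Finset.prod_congr rfl fun w _ => ?_
  rw [Pi.pow_apply, norm_pow, norm_eq_coe_normAbs']

end Summit.HodgeConjecture.HodgeConjecture.Cruxes.HLiu418.K2LiuKRFramePartnerSlice

end
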